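import Summits.BirchSwinnertonDyer.BirchSwinnertonDyer.Theorems.TeichmullerTwistDescentTameExponent
import Literature.NumberTheory.DiophantineGeometry.ConductorFactorizationProofs
import Literature.NumberTheory.DiophantineGeometry.ConductorExponentLeTwoProofs
import Literature.NumberTheory.EllipticCurves.FullLevelHomologySerreWeightOfEigenMap
import Literature.NumberTheory.EllipticCurves.Kraus1997.PTorsionInertiaPotentiallyGoodOrdinary
import Literature.NumberTheory.EllipticCurves.KellerYin2024.PotentiallyGoodOrdinaryPConverse
import Literature.NumberTheory.EllipticCurves.OrdinaryReductionTorsionLineProofs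
import Literature.NumberTheory.GaloisRepresentations.InertiaShapeTwistProofs
import Literature.NumberTheory.GaloisRepresentations.SerreWeightLevelOneEvaluationOfUniqueProofs
import Literature.NumberTheory.GaloisRepresentations.FundamentalCharacterCyclotomicProofs
import Literature.NumberTheory.GaloisRepresentations.ModPCyclotomicCharacterInertiaSurjective
import Literature.NumberTheory.GaloisRepresentations.FramedRepTwistEulerFactorProofs
import Literature.NumberTheory.Automorphic.SerreConjectureProofs
import Literature.NumberTheory.Automorphic.CDTTheorem722SerreProofs
import Literature.NumberTheory.Automorphic.BCDTModularitySerreProofs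
import Literature.NumberTheory.Automorphic.EdixhovenWeightMinimality
import HarnessLib

/-!
# Route `TeichmullerTwistDescent`, crux K `TwistedPeriodLatticeSaturation` (stmt-BirchSwinnertonDyer-25368):
# the weight exclusion (W‴) on KODAIRA TYPE II (`ord_pΔ_min = 2`, `e = 6`) from published facts — Serre weights of the
# full-level carrier (Buzzard–Diamond–Jarvis), Kraus 1997 Prop. 1, Edixhoven 1992 Thm. 4.5, uniqueness of Serre's weight

Cell `pub/bsd-wall` (D-0145 line route-BirchSwinnertonDyer-TeichmullerTwistDescent, OPEN rev 7), seat `bsd-line-ttd-p1`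
(prover 1/2, g27).  THEOREMS ONLY; `--supports stmt-BirchSwinnertonDyer-25368`.  BSD is not proved by this file; K is NOT proved
by this file; nothing here closes an item.

WHAT.  (W‴) `NoEtaleWeightEigenQuotient` (`TeichmullerTwistDescentCarrierDefs`) is the last route-posited input of the K-line
(K ⟸ `exists_isNewformOf` ∧ TYPE_central ∧ W‴, `TeichmullerTwistDescentKOfTameTypeCentral`).  This file proves ITS RESTRICTION TO
KODAIRA TYPE II (`padicValInt p Δ_min = 2`, semistability defect `e = 6`, `6b = p − 1`, `b = tameExponent p W`) from cite-only
published facts taken as hypotheses: (WEIGHT) `fullLevelHomology_twist_isModular_of_eigenMap` (Buzzard–Diamond–Jarvis 2010 §2 with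
Ash–Stevens), (SHAPE) `Kraus1997.propOne_inertiaShape_of_ordinary` (Kraus 1997 Prop. 1), (MIN)
`Automorphic.edixhoven1992_serreWeight_le_weight_of_newform` (Edixhoven 1992 Thm. 4.5), (UNIQ) `ModPGaloisRep.IsSerreWeight.unique`
(Serre 1987 §2.4, the tree's named fact) and the tree statement `isSerreWeight_serreWeightLocal` (proved in the tree as
`SerreWeightRecipeProofs.isSerreWeight_serreWeightLocal_holds`; taken as a hypothesis here only because that module is outside this
file's import closure).

HOW (`false_of_twist_isModular`).  A nonzero equivariant Hecke-eigen `Θ : H₁(Γ₀(M), ℤ_p[GL₂(𝔽_p)]) → Sym^{2b} ⊗ det^{−b}` gives by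
(WEIGHT) a newform `f` of weight `2b + 2`, level prime to `p`, with `ρ̄_f ≅ ω^s ⊗ ρ̄_W ⊗ 𝔽̄_p` and `p − 1 ∣ 2(s − b)`.  By (SHAPE)
`ρ̄_W|I_p ∼ (ω^{1−b} ∗; 0 ω^b)`, so `(ω^s ρ̄_W)|I_p ∼ (ω^{1−b+s} ∗; 0 ω^{b+s})` (`HasLevelOneInertiaShape.twist`), i.e. shape
`(1 + r, 2b + r)` with `r = (s + 5b) mod 6b ∈ {0, 3b}`; uniqueness of the weight evaluates Serre's recipe:
`k(ω^s ρ̄_W) = 1 + p(1 + r) + 2b + r ≥ p + 1` (`serreWeight_eq_of_hasLevelOneInertiaShape_of_unique`), while (MIN) gives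
`k ≤ 2b + 2 = (p − 1)/3 + 2` (the determinant of `ω^s ρ̄_W` is `ω^{2s+1} ≠ 1` on `I_p`).  Contradiction.
Type IV (`e = 3`) needs a basis swap in the tame sub-case `r = (p−1)/2`; type III (`e = 4`) needs the sign `s ≡ b`; neither is
claimed here.
-/

set_option autoImplicit false
-- single-conjunct summit: `Summit.BirchSwinnertonDyer.BirchSwinnertonDyer.…` repeats the name by design
set_option linter.dupNamespace false

noncomputable section

open scoped MatrixGroups NumberField Valued
open Function CongruenceSubgroup IsDedekindDomain ValuativeRel
open Literature.RepresentationTheory.FiniteGroups Literature.RepresentationTheory.FiniteGroups.GL2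
  Literature.NumberTheory.EllipticCurves.ModularForms
open Literature.NumberTheory.EllipticCurves (Kato2004.teichmullerChar)
open Literature.NumberTheory.ModularSymbols Literature.NumberTheory.ModularSymbols.FullLevel
open Literature.NumberTheory.GaloisRepresentations Literature.NumberTheory.GaloisRepresentations.ModPGaloisRep
open Literature.NumberTheory.GaloisRepresentations.IsNonarchimedeanLocalField
open Literature.NumberTheory.Automorphic

namespace Summit.BirchSwinnertonDyer.BirchSwinnertonDyer.Theorems.TeichmullerTwistDescent

open WeierstrassCurve Literature.NumberTheory.EllipticCurves Literature.NumberTheory.EllipticCurves.Rank1Residual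
open Summit.BirchSwinnertonDyer.BirchSwinnertonDyer.Theses.TeichmullerTwistDescent

namespace WeightExclusion

/-! ### Local pieces: restriction of a twist, its determinant on inertia, its inertia shape -/

section Local

variable {p : ℕ} [Fact p.Prime] {k : Type} [Field k] [TopologicalSpace k] [DiscreteTopology k]

/-- Restriction to `Γ_F` commutes with twisting: `(ρ ⊗ χ)|_F = ρ|_F ⊗ χ|_F`. [folklore] -/
theorem restrictField_twist (F : Type) [Field F] [Algebra ℚ F] (ρ : ModPGaloisRep ℚ k 2)
    (χ : Field.absoluteGaloisGroup ℚ →ₜ* kˣ) :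
    FramedGaloisRep.restrictField F (FramedRep.twist ρ χ) =
      FramedRep.twist (FramedGaloisRep.restrictField F ρ) (χ.comp (absGaloisRestrict ℚ F)) :=
  ContinuousMonoidHom.ext fun _ => rfl

/-- **`det(ω^s ⊗ ρ̄ ⊗ k) = ω^{2s+1}` is non-trivial on `I_p`** (`p` odd): if `det ρ̄ = χ̄_p` then at an inertia element `σ` with
`χ̄_p(σ) = −1` (`exists_mem_absInertia_modPCyclotomicCharacterZMod_eq`) the determinant of the twisted local representation is
`(−1)^{2s}·(−1) = −1 ≠ 1`. [folklore] -/
theorem exists_det_twist_ne_one [CharP k p] (hp2 : p ≠ 2) {ρ : ModPGaloisRep ℚ (ZMod p) 2}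
    (hdet : ∀ σ : Field.absoluteGaloisGroup ℚ, Matrix.GeneralLinearGroup.det (ρ σ) = modPCyclotomicCharacterZMod ℚ p σ)
    (j : ZMod p →+* k) (loc : LocalRestrictionAt p (FramedRep.baseChange j continuous_of_discreteTopology ρ)) (s : ℕ) :
    ∃ σ ∈ absInertia loc.F, Matrix.GeneralLinearGroup.det
      ((FramedRep.twist loc.rep ((modPCyclotomicCharacter ℚ k p j ^ s).comp (absGaloisRestrict ℚ loc.F)) :
        ModPGaloisRep loc.F k 2) σ) ≠ 1 := by
  haveI := neZero_natCast_of_irreducible loc.irreducible_natCast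
  obtain ⟨σ, hσ, hχ⟩ := exists_mem_absInertia_modPCyclotomicCharacterZMod_eq (F := loc.F) (p := p)
    loc.irreducible_natCast loc.residueFieldCard_eq (-1)
  refine ⟨σ, hσ, fun h1 => ?_⟩
  have hω : ((modPCyclotomicCharacter ℚ k p j ^ s).comp (absGaloisRestrict ℚ loc.F)) σ =
      (Units.map (j : ZMod p →* k) (-1)) ^ s := by
    show (modPCyclotomicCharacter ℚ k p j ^ s) (absGaloisRestrict ℚ loc.F σ) = _
    rw [ContinuousMonoidHom.pow_apply]
    congr 1
    ext
    rw [coe_modPCyclotomicCharacter_apply, modPCyclotomicCharacterZMod_absGaloisRestrict ℚ loc.F p σ, hχ]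
    rfl
  rw [FramedRep.det_twist_apply, hω, loc.rep_apply, FramedRep.baseChange_apply, Matrix.GeneralLinearGroup.map_det,
    hdet, modPCyclotomicCharacterZMod_absGaloisRestrict ℚ loc.F p σ, hχ] at h1
  have h2 := congrArg (fun u : kˣ => (u : k)) h1
  simp only [Units.val_mul, Units.val_pow_eq_pow_val, Units.coe_map, MonoidHom.coe_coe, Units.val_neg,
    Units.val_one, map_neg, map_one] at h2
  rw [← pow_mul, pow_mul', neg_one_sq, one_pow, one_mul] at h2
  exact Ring.neg_one_ne_one_of_char_ne_two (by rw [ringChar.eq k p]; exact hp2) h2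

/-- **The inertia shape of a cyclotomic twist at a local restriction datum**: if `loc.rep|I ∼ (ψ₁^a ∗; 0 ψ₁^b)` then
`(loc.rep ⊗ ω^s|_F)|I ∼ (ψ₁^{a+s} ∗; 0 ψ₁^{b+s})` — `ψ₁ = ω` on `I_F` for `F` with residue field `𝔽_p` and uniformiser `p`
(`LocalRestrictionAt.coe_fundamentalCharacter_one_eq_modPCyclotomicCharacter`) and `ω_ℚ ∘ res = ω_F`
(`modPCyclotomicCharacterZMod_absGaloisRestrict`). [cite: Serre1987, §2.2] -/
theorem hasLevelOneInertiaShape_twist_pow {ρ : ModPGaloisRep ℚ k 2} (loc : LocalRestrictionAt p ρ)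
    (ι : absIntegers 𝒪[loc.F] loc.F ⧸ absMaximalIdeal loc.F →+* k) (j : ZMod p →+* k) {a b : ℕ}
    (h : loc.rep.HasLevelOneInertiaShape ι ((p : ℕ) : 𝒪[loc.F]) loc.irreducible_natCast a b) (s : ℕ) :
    ModPGaloisRep.HasLevelOneInertiaShape
      (FramedRep.twist loc.rep ((modPCyclotomicCharacter ℚ k p j ^ s).comp (absGaloisRestrict ℚ loc.F)) :
        ModPGaloisRep loc.F k 2) ι ((p : ℕ) : 𝒪[loc.F]) loc.irreducible_natCast (a + s) (b + s) := by
  haveI := neZero_natCast_of_irreducible loc.irreducible_natCast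
  refine h.twist _ s fun σ => ?_
  show ((modPCyclotomicCharacter ℚ k p j ^ s) (absGaloisRestrict ℚ loc.F σ) : k) = _
  rw [ContinuousMonoidHom.pow_apply, Units.val_pow_eq_pow_val, Units.val_pow_eq_pow_val, coe_modPCyclotomicCharacter_apply,
    modPCyclotomicCharacterZMod_absGaloisRestrict ℚ loc.F p σ, loc.coe_fundamentalCharacter_one_eq_modPCyclotomicCharacter ι j σ,
    coe_modPCyclotomicCharacter_apply]

/-- Elementary: `r + n·m ≡ r (mod n)` phrased for residues — if `x = 3b·c` then `x mod 6b = 3b·(c mod 2) ≤ 3b`. [folklore] -/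
theorem mod_six_mul_of_eq_three_mul (b c x : ℕ) (hx : x = 3 * b * c) :
    x % (6 * b) = 3 * b * (c % 2) ∧ 3 * b * (c % 2) ≤ 3 * b := by
  refine ⟨?_, ?_⟩
  · rw [hx, show 6 * b = 3 * b * 2 by ring, Nat.mul_mod_mul_left]
  · have hc : c % 2 ≤ 1 := Nat.lt_succ_iff.mp (Nat.mod_lt c two_pos)
    simpa using Nat.mul_le_mul_left (3 * b) hc

end Local

/-- **`N_W = p²M` with `p ≥ 5` forces `p ∤ M`**: the conductor exponent at `p ≥ 5` is at most `2`
(`conductorExponent_le_two_of_five_le_natGenerator_holds`, `factorization_conductorNorm_holds`).  (Same computation as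
`KOfCarrier.conductorNorm_eq_sq_mul_coprime`, restated to keep this file outside the route cone.) [cite: SilvermanATAEC1994, Thm. IV.10.2] -/
theorem coprime_of_conductorNorm_eq_sq_mul (W : WeierstrassCurve ℚ) [W.IsElliptic] (p M : ℕ) [hp : Fact p.Prime] (hp5 : 5 ≤ p)
    (hN : W.conductorNorm ℤ = p ^ 2 * M) : Nat.Coprime p M := by
  set v₀ : IsDedekindDomain.HeightOneSpectrum ℤ := (Rat.HeightOneSpectrum.primesEquiv (R := ℤ)).symm ⟨p, hp.out⟩ with hv₀
  have hgen : Rat.HeightOneSpectrum.natGenerator v₀ = p :=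
    congrArg (fun q : Nat.Primes => (q : ℕ)) ((Rat.HeightOneSpectrum.primesEquiv (R := ℤ)).apply_symm_apply ⟨p, hp.out⟩)
  have hN0 : W.conductorNorm ℤ ≠ 0 := (W.conductorNorm_pos_holds).ne'
  have hf : (W.conductorNorm ℤ).factorization p ≤ 2 := by
    have h := W.factorization_conductorNorm_holds v₀
    rw [hgen] at h
    rw [h]
    exact W.conductorExponent_le_two_of_five_le_natGenerator_holds v₀ (by rw [hgen]; exact hp5)
  have h2 : 2 ≤ (W.conductorNorm ℤ).factorization p := (hp.out.pow_dvd_iff_le_factorization hN0).mp ⟨M, hN⟩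
  have hfac : (W.conductorNorm ℤ).factorization p = 2 := le_antisymm hf h2
  refine (Nat.Prime.coprime_iff_not_dvd hp.out).mpr ?_
  have h := Nat.not_dvd_ordCompl hp.out hN0
  rwa [hfac, hN, Nat.mul_div_cancel_left _ (pow_pos hp.out.pos 2)] at h

/-! ### The contradiction, for a fixed coefficient field -/

/-- **No newform of weight `2b + 2` and level prime to `p` carries a cyclotomic twist of `ρ̄_W ⊗ 𝔽̄_p` on type II.**  Coefficient
field `k` (algebraically closed, characteristic `p`, discrete); `6b = p − 1`, `p ≥ 13`; `ρ̄` a framed model of `W[p]` with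
`det ρ̄ = χ̄_p`, absolutely irreducible, of Kraus shape `(ω^{p−b} ∗; 0 ω^b)` at every local restriction datum of `ρ̄ ⊗_j k`;
`f` a newform on `Γ₁(N)`, `p ∤ N`, of weight `2b + 2` with `ρ̄_f ≅ ω^s ρ̄ ⊗ k` away from `Np`, `p − 1 ∣ 2(s + 5b)`.  Then `False`:
Serre's recipe at the twisted datum gives `k(ω^s ρ̄) = 1 + p(1 + r) + 2b + r ≥ p + 1` (`r ∈ {0, 3b}`), Edixhoven's minimality
gives `k(ω^s ρ̄) ≤ 2b + 2 < p`. [cite: Edixhoven1992, Thm. 4.5] [cite: Serre1987, §2.2–2.4] [cite: Kraus1997Dissertationes, Prop. 1] -/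
theorem false_of_twist_isModular {p : ℕ} [Fact p.Prime] {k : Type} [Field k] [TopologicalSpace k] [DiscreteTopology k]
    [CharP k p] [IsAlgClosed k]
    (hEd : edixhoven1992_serreWeight_le_weight_of_newform)
    (hUq : ∀ {F : Type} [Field F] [ValuativeRel F] [TopologicalSpace F] [IsNonarchimedeanLocalField F]
      (τ : ModPGaloisRep F k 2) (ι : absIntegers 𝒪[F] F ⧸ absMaximalIdeal F →+* k), IsSerreWeight.unique τ ι)
    (hS : ∀ {F : Type} [Field F] [ValuativeRel F] [TopologicalSpace F] [IsNonarchimedeanLocalField F]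
      (τ : ModPGaloisRep F k 2) (ι : absIntegers 𝒪[F] F ⧸ absMaximalIdeal F →+* k), τ.isSerreWeight_serreWeightLocal ι)
    {b : ℕ} (h6b : 6 * b = p - 1) (hb2 : 2 ≤ b) {ρ : ModPGaloisRep ℚ (ZMod p) 2}
    (hdet : ∀ σ : Field.absoluteGaloisGroup ℚ, Matrix.GeneralLinearGroup.det (ρ σ) = modPCyclotomicCharacterZMod ℚ p σ)
    (habs : FramedRep.IsAbsolutelyIrreducible ρ) (j : ZMod p →+* k)
    (hKr : ∀ (loc : LocalRestrictionAt p (FramedRep.baseChange j continuous_of_discreteTopology ρ))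
      (ι : absIntegers 𝒪[loc.F] loc.F ⧸ absMaximalIdeal loc.F →+* k),
      loc.rep.HasLevelOneInertiaShape ι ((p : ℕ) : 𝒪[loc.F]) loc.irreducible_natCast (p - b) b)
    {s : ℕ} (hs : (p - 1) ∣ 2 * (s + (p - 1 - b))) {N : ℕ} [NeZero N] (hpN : ¬ p ∣ N)
    (f : CuspForm (Gamma1 N) (((2 * b : ℕ) : ℤ) + 2)) (ιf : coeffCharIntegers f →+* k) (hf : IsNewform1 f)
    (hgal : IsGaloisRepOfNewform1Int f ιf {q | q ∣ N * p}
      (FramedRep.twist (FramedRep.baseChange j continuous_of_discreteTopology ρ) (modPCyclotomicCharacter ℚ k p j ^ s))) :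
    False := by
  have hp : p.Prime := Fact.out
  have hp13 : 13 ≤ p := by omega
  have hp2 : p ≠ 2 := by omega
  -- irreducibility and oddness of the twist
  have hirrbc : (FramedRep.baseChange j continuous_of_discreteTopology ρ).toContinuousRep.IsIrreducible :=
    habs.isIrreducible_baseChange k j _
  have hirr' : (FramedGaloisRep.toGaloisRep (K := ℚ)
      (FramedRep.twist (FramedRep.baseChange j continuous_of_discreteTopology ρ) (modPCyclotomicCharacter ℚ k p j ^ s) :
        ModPGaloisRep ℚ k 2)).IsIrreducible := by
    refine FramedRep.isIrreducible_of_twist (χ := modPCyclotomicCharacter ℚ k p j ^ s) (fun g => ?_) hirrbc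
    rw [FramedRep.twist_apply]
    congr 1
  have hodd : FramedGaloisRep.IsOdd (FramedRep.baseChange j continuous_of_discreteTopology ρ) :=
    (ModPGaloisRep.isOdd_of_det_eq_modPCyclotomicCharacterZMod ρ hdet).baseChange j _
  have hodd' : FramedGaloisRep.IsOdd
      (FramedRep.twist (FramedRep.baseChange j continuous_of_discreteTopology ρ) (modPCyclotomicCharacter ℚ k p j ^ s)) := by
    intro φ c hc
    rw [FramedRep.det_twist_apply, ← map_pow, hc.sq_eq_one, map_one, one_mul]
    exact hodd φ c hc
  -- a local restriction datum of the base change, a residue embedding, and the twisted datum on the same field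
  obtain ⟨loc₀⟩ := nonempty_localRestrictionAt p (FramedRep.baseChange j continuous_of_discreteTopology ρ)
  obtain ⟨ι⟩ := nonempty_ringHom_residue (k := k) p loc₀.F loc₀.residueFieldCard_eq
  have hι : Function.Injective ι := by
    letI : Field (absIntegers 𝒪[loc₀.F] loc₀.F ⧸ absMaximalIdeal loc₀.F) := Ideal.Quotient.field _
    exact ι.injective
  let loc' : LocalRestrictionAt p
      (FramedRep.twist (FramedRep.baseChange j continuous_of_discreteTopology ρ) (modPCyclotomicCharacter ℚ k p j ^ s) :
        ModPGaloisRep ℚ k 2) :=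
    { F := loc₀.F
      residueFieldCard_eq := loc₀.residueFieldCard_eq
      irreducible_natCast := loc₀.irreducible_natCast
      rep := FramedRep.twist loc₀.rep ((modPCyclotomicCharacter ℚ k p j ^ s).comp (absGaloisRestrict ℚ loc₀.F))
      rep_eq_restrictField := by rw [loc₀.rep_eq_restrictField, restrictField_twist] }
  -- Edixhoven: `k(ω^s ρ̄) ≤ 2b + 2`
  have hdet' : ∃ σ ∈ absInertia loc'.F, Matrix.GeneralLinearGroup.det (loc'.rep σ) ≠ 1 :=
    exists_det_twist_ne_one hp2 hdet j loc₀ s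
  have hle := hEd p (hp.odd_of_ne_two hp2) k _ hirr' hodd' N hpN (((2 * b : ℕ) : ℤ) + 2) (by omega) f ιf hf hgal loc' ι hdet'
  -- the shape of the twist: `(p - b + s, b + s) ≡ (1 + r, 2b + r)` mod `p - 1`, `r = (s + 5b) mod 6b ∈ {0, 3b}`
  have hsh := hasLevelOneInertiaShape_twist_pow loc₀ ι j (hKr loc₀ ι) s
  have h5b : p - 1 - b = 5 * b := by omega
  obtain ⟨c, hc⟩ := hs
  rw [h5b, ← h6b] at hc
  have hx : s + 5 * b = 3 * b * c := Nat.eq_of_mul_eq_mul_left two_pos (by rw [hc]; ring)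
  obtain ⟨hmod, hrle⟩ := mod_six_mul_of_eq_three_mul b c (s + 5 * b) hx
  generalize hr : 3 * b * (c % 2) = r at hmod hrle
  have hsr : s + 5 * b ≡ r [MOD p - 1] := by
    unfold Nat.ModEq
    rw [← h6b, hmod, Nat.mod_eq_of_lt (by omega)]
  have hq : residueFieldCard loc₀.F - 1 = p - 1 := by rw [loc₀.residueFieldCard_eq]
  have hβ : p - b + s ≡ r + 1 [MOD residueFieldCard loc₀.F - 1] := by
    rw [hq, show p - b + s = s + 5 * b + 1 by omega]
    exact hsr.add_right 1
  have hα : b + s ≡ 2 * b + r [MOD residueFieldCard loc₀.F - 1] := by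
    rw [hq]
    refine Nat.ModEq.add_right_cancel' (4 * b) ?_
    rw [show b + s + 4 * b = s + 5 * b by omega, show 2 * b + r + 4 * b = r + (p - 1) by omega]
    exact hsr.trans Nat.add_modEq_right.symm
  have hsh' : loc'.rep.HasLevelOneInertiaShape ι ((p : ℕ) : 𝒪[loc'.F]) loc'.irreducible_natCast (r + 1) (2 * b + r) :=
    hsh.of_modEq hβ hα
  -- Serre's recipe evaluated by uniqueness: `k(ω^s ρ̄) = 1 + p (r + 1) + (2b + r)`
  have hwt : serreWeight p _ loc' ι = 1 + p * (r + 1) + (2 * b + r) :=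
    serreWeight_eq_of_hasLevelOneInertiaShape_of_unique loc' ι (hUq loc'.rep ι) hι (hS loc'.rep ι) hsh'
      (by omega) (by omega) (by omega)
  have hge : p + 1 ≤ serreWeight p _ loc' ι := by
    rw [hwt]
    have : p ≤ p * (r + 1) := Nat.le_mul_of_pos_right p (by omega)
    omega
  omega

/-! ### (W‴) on Kodaira type II from the four facts -/

/-- **(W‴) `NoEtaleWeightEigenQuotient` restricted to Kodaira type II (`ord_pΔ_min = 2`), from published facts.**  Under the prefix
of (W‴) (`N_W = p²M`, `p ≥ 11`, additive, `E[p]` irreducible, (G)-ordinary, `ord_pΔ_min ≤ 4`) AND `ord_pΔ_min = 2`, every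
`GL₂(𝔽_p)`-equivariant `ℤ_p`-linear map `Θ` from the full-level carrier to `Sym^{2b}(𝔽_p²) ⊗ det^{p−1−b}` (`b = tameExponent p W`)
on which the Hecke operators `T_q`, `q ∤ pM… q ≠ p`, act by `a_q(W)` is zero — granted (WEIGHT)
`fullLevelHomology_twist_isModular_of_eigenMap`, (SHAPE) `Kraus1997.propOne_inertiaShape_of_ordinary`, (MIN)
`edixhoven1992_serreWeight_le_weight_of_newform`, (UNIQ) `IsSerreWeight.unique` and `isSerreWeight_serreWeightLocal` for every
local mod-`p` representation with algebraically closed coefficients.  Proof: `false_of_twist_isModular` with `p ∤ M`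
(`coprime_of_conductorNorm_eq_sq_mul`), a framed model of `W[p]` (`exists_isTorsionGaloisRep`, `det = χ̄_p` by the Weil
pairing, absolutely irreducible for `p ≠ 2`), `k = 𝔽̄_p` discrete, and `6b = p − 1` on type II (`tameExponent_cases`).
[cite: BuzzardDiamondJarvis2010, §2 Prop. 2.5, Cor. 2.10] [cite: Kraus1997Dissertationes, Prop. 1] [cite: Edixhoven1992, Thm. 4.5]
[cite: Serre1987, §2.2–2.4] -/
theorem noEtaleWeightEigenQuotient_typeII_of_facts
    (hWt : fullLevelHomology_twist_isModular_of_eigenMap)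
    (hKr : Kraus1997.propOne_inertiaShape_of_ordinary)
    (hEd : edixhoven1992_serreWeight_le_weight_of_newform)
    (hUq : ∀ {k : Type} [Field k] [TopologicalSpace k] {F : Type} [Field F] [ValuativeRel F] [TopologicalSpace F]
      [IsNonarchimedeanLocalField F] (τ : ModPGaloisRep F k 2) (ι : absIntegers 𝒪[F] F ⧸ absMaximalIdeal F →+* k),
      IsSerreWeight.unique τ ι)
    (hS : ∀ {k : Type} [Field k] [TopologicalSpace k] {F : Type} [Field F] [ValuativeRel F] [TopologicalSpace F]
      [IsNonarchimedeanLocalField F] (τ : ModPGaloisRep F k 2) (ι : absIntegers 𝒪[F] F ⧸ absMaximalIdeal F →+* k),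
      τ.isSerreWeight_serreWeightLocal ι)
    (p M : ℕ) [Fact p.Prime] [NeZero M] (W : WeierstrassCurve ℚ) [W.IsElliptic] [W.IsGloballyMinimal]
    (hN : W.conductorNorm ℤ = p ^ 2 * M) (hp11 : 11 ≤ p) (hadd : Rank1Residual.Addv W p) (hirr : Rank1Residual.Irr W p)
    (hGo : Summit.BirchSwinnertonDyer.Rank1Residual.Additive.TypeGOrd W p) (hV4 : padicValInt p W.minimalDiscriminantInt ≤ 4)
    (hII : padicValInt p W.minimalDiscriminantInt = 2) :
    letI : Algebra ℤ_[p] (ZMod p) := (PadicInt.toZMod (p := p)).toAlgebra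
    ∀ Θ : H1carrier ℤ_[p] p M →ₗ[ℤ_[p]] ↥(MvPolynomial.homogeneousSubmodule (Fin 2) (ZMod p) (2 * tameExponent p W)),
    (∀ (g : GL (Fin 2) (ZMod p)) (z : H1carrier ℤ_[p] p M),
        Θ (H1carrierRep ℤ_[p] p M g z) =
          symPowTwist (ZMod.castHom (dvd_refl p) (ZMod p))
            (reduceChar (ZMod p) (Kato2004.teichmullerChar p ^ (p - 1 - tameExponent p W)))
            (2 * tameExponent p W) g (Θ z)) →
    (∀ (q : ℕ) [NeZero q] (hq : q.Prime) (hqp : q ≠ p) (z : H1carrier ℤ_[p] p M),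
        Θ (heckeT ℤ_[p] p M hq hqp z) = (((W.LFunction q : ℤ) : ZMod p)) • Θ z) →
    Θ = 0 := by
  intro Θ hΘG hΘT
  by_contra hΘ0
  have hp : p.Prime := Fact.out
  have hp5 : 5 ≤ p := le_trans (by norm_num) hp11
  have hp2 : p ≠ 2 := by omega
  -- type II arithmetic: `6 b = p - 1`, `2 ≤ b`
  have h6b : 6 * tameExponent p W = p - 1 := by
    rcases TameExponent.tameExponent_cases W p hp5 hadd hGo hV4 with ⟨_, _, h⟩ | ⟨h3, _, _⟩ | ⟨h4, _, _⟩
    · exact h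
    · omega
    · omega
  have hb2 : 2 ≤ tameExponent p W := TameExponent.two_le_tameExponent W p hp11 hadd hGo hV4
  -- `p ∤ M`
  have hpM : Nat.Coprime p M := coprime_of_conductorNorm_eq_sq_mul W p M hp5 hN
  -- a framed model of `W[p]`, coefficients `𝔽̄_p`
  haveI : NeZero ((p : ℕ) : ℚ) := ⟨by exact_mod_cast hp.ne_zero⟩
  obtain ⟨ρ, hρ⟩ := W.exists_isTorsionGaloisRep p
  letI : TopologicalSpace (AlgebraicClosure (ZMod p)) := ⊥
  haveI : DiscreteTopology (AlgebraicClosure (ZMod p)) := ⟨rfl⟩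
  -- (WEIGHT)
  obtain ⟨s, N, hN0, f, ιf, hsdiv, hpN, hf, hgal⟩ :=
    hWt p M W (2 * tameExponent p W) (p - 1 - tameExponent p W) hp5 hpM (by omega) ⟨2, by omega⟩ hirr
      ⟨Θ, hΘ0, hΘG, hΘT⟩ ρ hρ (AlgebraicClosure (ZMod p)) (algebraMap (ZMod p) (AlgebraicClosure (ZMod p)))
  haveI := hN0
  -- (SHAPE) needs potentially good ordinary reduction
  have hPGO : W.HasPotentiallyGoodOrdinaryReductionAtPrime p :=
    W.hasPotentiallyGoodOrdinaryReductionAtPrime_of_forall_intermediateField p hp hGo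
  exact false_of_twist_isModular hEd hUq hS h6b hb2 (W.det_eq_modPCyclotomicCharacter_of_isTorsionGaloisRep_holds p ρ hρ)
    (BCDT.isAbsolutelyIrreducible_of_hasIrreducibleModPGaloisRep W hp2 hirr hρ) (algebraMap (ZMod p) (AlgebraicClosure (ZMod p)))
    (fun loc ι => hKr p hp5 W hadd hPGO ρ hρ (AlgebraicClosure (ZMod p)) _ continuous_of_discreteTopology loc ι)
    hsdiv hpN f ιf hf hgal

end WeightExclusion

end Summit.BirchSwinnertonDyer.BirchSwinnertonDyer.Theorems.TeichmullerTwistDescent
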